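import Mathlib

/-!
# Self-converse lift of a gadget of direct pairs — additive-homomorphism form (support file)

Item `stmt-MatrixMultiplication-14308` (`FourierTwoFamiliesModP.PrimeTwoFamilies`, CKSU 2005 Conj. 4.7 with
prime cyclic hosts), line `Sketch` (capacity-gadget form), registered stub `selfConverseLift`
(siege attempt k9, variation: Mathlib API route).

A GADGET is a list `(P σ, Q σ)_{σ<r}` of finite subsets of an abelian group `K`, each pair DIRECT
(`(x - x') + (y - y') = 0 → x = x' ∧ y = y'` inside one pair).  Letter `σ` is STRONGLY SEPARATED towards
`τ` if every cross difference `q - p` (`p ∈ P σ`, `q ∈ Q τ`) differs from every diagonal difference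
`q' - p'` (`p' ∈ P c`, `q' ∈ Q c`, any letter `c`).  `selfConverseLift`: if a map `π` on the letters
strongly separates every ordered pair of distinct letters either directly or after `π`, then the `r`
graph-word blocks `(P σ ×ˢ P (π σ), Q σ ×ˢ Q (π σ))` in `K × K` satisfy clauses (W) and (X) of the
simultaneous double product property, verbatim as inlined in the route `FourierTwoFamiliesModP`.

Proof organisation (Mathlib API route).  The relation `(a - a') + (b - b') = 0` is functorial: it is
transported along any additive monoid homomorphism (`rel_map`, via `map_add` / `map_sub` / `map_zero`),
and it is read in the two coordinates of the product group `K × K` by transporting it along the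
coordinate functionals `AddMonoidHom.fst K K` and `AddMonoidHom.snd K K` (no separate projection
lemmas: `⇑(AddMonoidHom.fst K K) a` is definitionally `a.1`).  In one coordinate the relation is, by
`sub_add_sub_comm`, `sub_eq_zero` and `sub_eq_sub_iff_add_eq_add`, the coincidence of the cross
difference `b' - a` with the diagonal difference `b - a'` (`rel_iff_cross_eq_diag`), which the
separation hypothesis forbids in the coordinate it names; clause (W) is directness in both coordinates
reassembled by `Prod.ext`.  Mathlib only; no route
declaration is imported (the stub is stated over Mathlib primitives).  The line's lead landed the same
statement as `Theorems.PrimeTwoFamilies.CapacityLift.selfConverseLift`; this file keeps its own namespace.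
-/

-- single-conjunct summit: the mandated namespace repeats `MatrixMultiplication` (summit = sub-problem).
set_option linter.dupNamespace false

namespace Summit.MatrixMultiplication.MatrixMultiplication.Theorems.PrimeTwoFamilies.SelfConverseLiftK9

/-- The one-coordinate core: in an abelian group, `(a - a') + (b - b') = 0` holds iff the cross
difference `b' - a` coincides with the diagonal difference `b - a'`
(`sub_add_sub_comm`, `sub_eq_zero`, `sub_eq_sub_iff_add_eq_add`). -/
theorem rel_iff_cross_eq_diag {K : Type*} [AddCommGroup K] (a a' b b' : K) :
    (a - a') + (b - b') = 0 ↔ b' - a = b - a' := by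
  rw [sub_add_sub_comm, sub_eq_zero, sub_eq_sub_iff_add_eq_add, add_comm b' a', add_comm b a]
  exact eq_comm

/-- Functoriality: the relation `(a - a') + (b - b') = 0` is transported along every additive monoid
homomorphism `f` (`map_add`, `map_sub`, `map_zero`). -/
theorem rel_map {G K : Type*} [AddCommGroup G] [AddCommGroup K] (f : G →+ K) {a a' b b' : G}
    (h : (a - a') + (b - b') = 0) : (f a - f a') + (f b - f b') = 0 := by
  simpa only [map_add, map_sub, map_zero] using congrArg f h

/-- **SELF-CONVERSE LIFT** (registered stub `selfConverseLift` of crux `PrimeTwoFamilies`, line `Sketch`;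
the `L = 2` zero-error code of graph words `(σ, π σ)`).  If every letter `(P c, Q c)` is direct (`hD`)
and a map `π` on the letters strongly separates every ordered pair of distinct letters either directly
or after `π` (`hπ`), then the `r` blocks `(P σ ×ˢ P (π σ), Q σ ×ˢ Q (π σ))` in `K × K` satisfy clause
(W) (first conjunct: each block pair is direct) and clause (X) (second conjunct:
`(a - a') + (b - b') = 0` with `a ∈ A i`, `a' ∈ A j`, `b ∈ B j`, `b' ∈ B k` forces `i = k`) of the
simultaneous double product property. -/
theorem selfConverseLift {K : Type*} [AddCommGroup K] [DecidableEq K] {r : ℕ}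
    (P Q : Fin r → Finset K)
    (hD : ∀ c : Fin r, ∀ x ∈ P c, ∀ x' ∈ P c, ∀ y ∈ Q c, ∀ y' ∈ Q c,
      (x - x') + (y - y') = 0 → x = x' ∧ y = y')
    (π : Fin r → Fin r)
    (hπ : ∀ σ τ : Fin r, σ ≠ τ →
      (∀ p ∈ P σ, ∀ q ∈ Q τ, ∀ c : Fin r, ∀ p' ∈ P c, ∀ q' ∈ Q c, q - p ≠ q' - p') ∨
      (∀ p ∈ P (π σ), ∀ q ∈ Q (π τ), ∀ c : Fin r, ∀ p' ∈ P c, ∀ q' ∈ Q c, q - p ≠ q' - p')) :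
    (∀ σ : Fin r, ∀ a ∈ P σ ×ˢ P (π σ), ∀ a' ∈ P σ ×ˢ P (π σ),
      ∀ b ∈ Q σ ×ˢ Q (π σ), ∀ b' ∈ Q σ ×ˢ Q (π σ),
        (a - a') + (b - b') = 0 → a = a' ∧ b = b') ∧
    (∀ i j k : Fin r, ∀ a ∈ P i ×ˢ P (π i), ∀ a' ∈ P j ×ˢ P (π j),
      ∀ b ∈ Q j ×ˢ Q (π j), ∀ b' ∈ Q k ×ˢ Q (π k),
        (a - a') + (b - b') = 0 → i = k) := by
  refine ⟨fun σ a ha a' ha' b hb b' hb' h => ?_, fun i j k a ha a' ha' b hb b' hb' h => ?_⟩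
  · -- (W): directness in each coordinate functional, reassembled by `Prod.ext`
    rw [Finset.mem_product] at ha ha' hb hb'
    obtain ⟨e₁, f₁⟩ := hD σ _ ha.1 _ ha'.1 _ hb.1 _ hb'.1 (rel_map (AddMonoidHom.fst K K) h)
    obtain ⟨e₂, f₂⟩ := hD (π σ) _ ha.2 _ ha'.2 _ hb.2 _ hb'.2 (rel_map (AddMonoidHom.snd K K) h)
    exact ⟨Prod.ext e₁ e₂, Prod.ext f₁ f₂⟩
  · -- (X): the separation hypothesis for the ordered pair `(i, k)` names a coordinate functional in
    -- which the transported relation is a forbidden coincidence of cross and diagonal differences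
    rw [Finset.mem_product] at ha ha' hb hb'
    by_contra hik
    rcases hπ i k hik with hs | hs
    · exact hs _ ha.1 _ hb'.1 j _ ha'.1 _ hb.1
        ((rel_iff_cross_eq_diag _ _ _ _).1 (rel_map (AddMonoidHom.fst K K) h))
    · exact hs _ ha.2 _ hb'.2 (π j) _ ha'.2 _ hb.2
        ((rel_iff_cross_eq_diag _ _ _ _).1 (rel_map (AddMonoidHom.snd K K) h))

end Summit.MatrixMultiplication.MatrixMultiplication.Theorems.PrimeTwoFamilies.SelfConverseLiftK9
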